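import Summits.CriticalPhenomena.PercolationContinuityZ3.Theorems.PercNearOneGluingNoHeavyLowerTailSahiCombMixCoord
import Summits.CriticalPhenomena.PercolationContinuityZ3.Theorems.PercNearOneGluingNoHeavyLowerTailSahiMixtureFourAtoms

/-!
# The comb (tensor-Bernstein) hierarchy for Sahi's `E_k`, XXXVI: Venn atoms of four events at the COMB level — the building blocks for lifting
# constant-multiplier certificates

Support file of the one-cut programme (crux `NoHeavyLowerTail`, stmt-CriticalPhenomena-4575; cell `prim-masterthm`, seat P3, gen 8;
`run/shared/lean/prim/prim-masterthm/prim-masterthm-p3/HIERARCHY.md` §15(d)).  Vocabulary: `SahiMixture.atom4` (Venn atoms of four events, `…SahiMixtureFourAtoms`),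
`SahiComb.CombPos`, sections `secAt`.
* `atom4_insert` — the atom indicators of events ignoring `e` ignore `e`; **`combPos_atom4_off`** — `p ↦ μ_p(atom)` is comb-positive at multidegree `1` OFF `e`.
* `combPos_mono2/mono3` — products of two/three such functions are comb-positive at multidegree `2`/`3` off `e` (degree bookkeeping lemmas `deg11`, `deg21`, `deg12`).
These are exactly what a constant-multiplier certificate `c_j = Σ λ(atoms)·row + N(atoms)` needs in order to lift to comb positivity: rows come from
`CombHereditary.row_off`, atoms and their products from here, sums/products/scalars from `CombPos.add/mul_of_eq/smul`. [this work]
-/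

noncomputable section

open scoped Classical

namespace Summit.CriticalPhenomena.PercolationContinuityZ3.Theorems

open Finset Function
open Literature.Combinatorics.Sahi2008
open Literature.Probability.Percolation.DecisionTree (ind ind_of_mem ind_of_not_mem ind_nonneg)
open SahiComb

variable {ι : Type} [Fintype ι]

namespace SahiCombMix

/-! ### Degree bookkeeping off `e` -/

omit [Fintype ι] in
/-- `(1 off e) + (1 off e) = (2 off e)`. [folklore] -/
theorem deg11 (e : ι) : update (fun _ : ι => (1 : ℕ)) e 0 + update (fun _ : ι => (1 : ℕ)) e 0 = update (fun _ : ι => 2) e 0 := by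
  funext x; by_cases hx : x = e
  · subst hx; simp
  · simp [hx]

omit [Fintype ι] in
/-- `(2 off e) + (1 off e) = (3 off e)`. [folklore] -/
theorem deg21 (e : ι) : update (fun _ : ι => (2 : ℕ)) e 0 + update (fun _ : ι => (1 : ℕ)) e 0 = update (fun _ : ι => 3) e 0 := by
  funext x; by_cases hx : x = e
  · subst hx; simp
  · simp [hx]

omit [Fintype ι] in
/-- `(1 off e) + (2 off e) = (3 off e)`. [folklore] -/
theorem deg12 (e : ι) : update (fun _ : ι => (1 : ℕ)) e 0 + update (fun _ : ι => (2 : ℕ)) e 0 = update (fun _ : ι => 3) e 0 := by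
  funext x; by_cases hx : x = e
  · subst hx; simp
  · simp [hx]

omit [Fintype ι] in
/-- `(k off e) ≤ (m off e)` for `k ≤ m`. [folklore] -/
theorem deg_off_mono (e : ι) {k m : ℕ} (h : k ≤ m) : update (fun _ : ι => k) e 0 ≤ update (fun _ : ι => m) e 0 := by
  intro x; by_cases hx : x = e
  · subst hx; simp
  · simp [hx, h]

/-! ### Atoms ignore `e` and are comb-positive off `e` -/

section Atoms

variable (U : Fin 4 → Set (Set ι)) (e : ι) (hUe : ∀ (j : Fin 4) (b : Bool), secAt e b (U j) = U j)
include hUe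

omit [Fintype ι] in
/-- Indicators of the `U_j` ignore `e`. [folklore] -/
theorem ind_U4_insert (j : Fin 4) (ω : Set ι) : ind (U j) (insert e ω) = ind (U j) ω := by
  rw [← hUe j true]; exact ind_secAt_insert e true (U j) ω

omit [Fintype ι] in
/-- The Venn atoms of the `U_j` ignore `e`. [this work] -/
theorem atom4_insert (b0 b1 b2 b3 : Bool) (ω : Set ι) :
    SahiMixture.atom4 U b0 b1 b2 b3 (insert e ω) = SahiMixture.atom4 U b0 b1 b2 b3 ω := by
  unfold SahiMixture.atom4
  rw [ind_U4_insert U e hUe, ind_U4_insert U e hUe, ind_U4_insert U e hUe, ind_U4_insert U e hUe]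

/-- **Atom masses are comb-positive at multidegree `1` off `e`.** [this work] -/
theorem combPos_atom4_off (b0 b1 b2 b3 : Bool) :
    CombPos (update (fun _ : ι => 1) e 0) (fun p => ex (bernoulliWeight p) (SahiMixture.atom4 U b0 b1 b2 b3)) :=
  (combPos_ex (ι := ι) (h := SahiMixture.atom4 U b0 b1 b2 b3) fun ω =>
      mul_nonneg (mul_nonneg (mul_nonneg (SahiMixture.lit_ind_nonneg _ _ ω) (SahiMixture.lit_ind_nonneg _ _ ω)) (SahiMixture.lit_ind_nonneg _ _ ω))
        (SahiMixture.lit_ind_nonneg _ _ ω)).of_ignores e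
    fun p s => SahiCombDisjunct.ex_update_of_ignores' e (fun ω => atom4_insert U e hUe b0 b1 b2 b3 ω) p s

end Atoms

/-! ### Products -/

/-- Product of two functions comb-positive at multidegree `1` off `e`. [this work] -/
theorem combPos_mono2 (e : ι) {f g : (ι → unitInterval) → ℝ} (hf : CombPos (update (fun _ : ι => 1) e 0) f)
    (hg : CombPos (update (fun _ : ι => 1) e 0) g) : CombPos (update (fun _ : ι => 2) e 0) (fun p => f p * g p) :=
  hf.mul_of_eq hg (deg11 e)

/-- Product of three functions comb-positive at multidegree `1` off `e`. [this work] -/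
theorem combPos_mono3 (e : ι) {f g k : (ι → unitInterval) → ℝ} (hf : CombPos (update (fun _ : ι => 1) e 0) f)
    (hg : CombPos (update (fun _ : ι => 1) e 0) g) (hk : CombPos (update (fun _ : ι => 1) e 0) k) :
    CombPos (update (fun _ : ι => 3) e 0) (fun p => f p * g p * k p) :=
  (combPos_mono2 e hf hg).mul_of_eq hk (deg21 e)

/-- A function comb-positive at multidegree `1` off `e` times one at multidegree `2` off `e`. [this work] -/
theorem combPos_mono12 (e : ι) {f g : (ι → unitInterval) → ℝ} (hf : CombPos (update (fun _ : ι => 1) e 0) f)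
    (hg : CombPos (update (fun _ : ι => 2) e 0) g) : CombPos (update (fun _ : ι => 3) e 0) (fun p => f p * g p) :=
  hf.mul_of_eq hg (deg12 e)

end SahiCombMix

end Summit.CriticalPhenomena.PercolationContinuityZ3.Theorems

end
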